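import Mathlib
import Summits.PneNP.PneNP.Theses.WitnessForging

-- every `Summit.PneNP.PneNP.…` name repeats the summit = sub-problem component (layout D-0017)
set_option linter.dupNamespace false

/-!
# Route WitnessForging — item `ForgingThesisOfPieces` (stmt-PneNP-17540): the deciding crux
# `ForgingThesis` DERIVED from its pieces (`ShatteredForgingHard ∧ WindowSatisfiable → ForgingThesis`)

`Summit.PneNP.PneNP.Theses.WitnessForging.ForgingThesis` (stmt-PneNP-2430) is the worst-case
statement "every PPT algorithm fails to `1/4`-forge the uniform witness measure `μ_φ` on SOME
satisfiable compact CNF `φ`". This file proves it from two pieces typed over the tree ensemble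
`Literature.Computability.Complexity.randomKCNF` (`F_k(n, m)`: `m` proper `k`-clauses i.i.d.):

* `ShatteredForgingHard` (crux stmt-PneNP-2434, a decl of the route file): for `k ≥ k₀` and
  `5·2^k ln k/k ≤ α ≤ 2^{k-1}`, every PPT `A` has `Pr_{Φ ∼ F_k(n,⌊αn⌋)}[Φ satisfiable ∧ A 1/4-forges
  μ_Φ] → 0`;
* `WindowSatisfiable` (support item stmt-PneNP-17539, a decl of the route file): for `k ≥ k₁` and `α ≤ 2^{k-1}` there is `ε > 0` with `Pr_{Φ ∼ F_k(n,⌊αn⌋)}[Φ satisfiable] ≥ ε` for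
  all large `n` — Achlioptas–Peres 2004, Thm 2 (`r_k ≥ 2^k ln 2 − (k+1) ln 2/2 − 1 − δ_k > 2^{k-1}` for
  large `k`; in the tree for the literal-array model as
  `Literature.Computability.Complexity.AchlioptasPeres2004_threshold_lower_bound_holds`), to be
  transferred to the proper-clause model by conditioning on properness.

Assembly (`forgingThesis_of_split`): fix a PPT `A`; at `k = max k₀ k₁ ⊔ 512` and `α = 2^k/2` — inside
the window because `10 ln k ≤ k` (`ForgingThesisSplit.window_lower_le_half`) — the mass of
`{Φ satisfiable ∧ forged by A}` is eventually `< ε/2` while `{Φ satisfiable}` keeps mass `≥ ε`, so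
their difference meets the support of `F_k(n, ⌊αn⌋)` (`ForgingThesisSplit.exists_mem_support_diff`);
such a `φ` is satisfiable, NOT forged by `A`, and compactly indexed: its variables are `< n`
(`ForgingThesisSplit.numVars_le_of_mem_support`) and `n ≤ ⌊αn⌋ = |φ| ≤ 2|φ| + 2 ≤ |enc φ|`
(`ForgingThesisSplit.numVars_le_length_encode_of_mem_support`).

References: D. Achlioptas, Y. Peres, *The threshold for random k-SAT is 2^k log 2 − O(k)*, J. Amer.
Math. Soc. 17 (2004) 947–973, Thm 2 [AchlioptasPeres2004]; D. Achlioptas, A. Coja-Oghlan,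
*Algorithmic barriers from phase transitions*, FOCS 2008 [doi:10.1109/focs.2008.11] (the window).
-/

namespace Summit.PneNP.PneNP.Theorems

namespace ForgingThesisSplit

open Literature.Computability.Complexity _root_.Computability Filter

/-! ### Support of the random ensemble: variables, length, code length -/

/-- Every variable of a `k`-clause over `n` variables is `< n`. [folklore] -/
theorem fst_lt_of_mem_kClauses {k n : ℕ} {c : Clause ℕ} (hc : c ∈ kClauses k n) {l : Literal ℕ}
    (hl : l ∈ c) : l.1 < n := by
  unfold kClauses at hc
  rw [Finset.mem_image] at hc
  obtain ⟨p, -, rfl⟩ := hc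
  unfold clauseOf at hl
  rw [List.mem_map] at hl
  obtain ⟨q, hq, rfl⟩ := hl
  obtain ⟨i, hi, hqi⟩ := (List.exists_mem_zipIdx' (p := fun x => x = q)).1 ⟨q, hq, rfl⟩
  have hmem : q.1 ∈ (p.1.sort (· ≤ ·)).map (fun v : Fin n => (v : ℕ)) := by
    rw [← hqi]
    exact List.getElem_mem hi
  rw [List.mem_map] at hmem
  obtain ⟨v, -, hv⟩ := hmem
  simp only
  rw [← hv]
  exact v.isLt

/-- A formula in the support of `F_k(n, m)` has all its variables `< n`, hence `numVars ≤ n`.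
[folklore] -/
theorem numVars_le_of_mem_support {k n m : ℕ} {φ : CNF ℕ}
    (hφ : φ ∈ (randomKCNF k n m).support) : φ.numVars ≤ n := by
  have hall := forall_mem_of_mem_support_randomKCNF hφ
  unfold CNF.numVars
  have key : ∀ (L : List ℕ), (∀ x ∈ L, x ≤ n) → L.foldr max 0 ≤ n := by
    intro L hL
    induction L with
    | nil => exact Nat.zero_le _
    | cons a L ih =>
      rw [List.foldr_cons]
      exact max_le (hL a List.mem_cons_self) (ih fun x hx => hL x (List.mem_cons_of_mem _ hx))
  refine key _ fun x hx => ?_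
  rw [List.mem_map] at hx
  obtain ⟨l, hl, rfl⟩ := hx
  rw [List.mem_flatten] at hl
  obtain ⟨c, hc, hlc⟩ := hl
  exact fst_lt_of_mem_kClauses (hall c hc) hlc

/-- A formula in the support of `F_k(n, m)` is either empty (junk branch `n < k`) or has exactly `m`
clauses. [folklore] -/
theorem length_eq_or_nil_of_mem_support {k n m : ℕ} {φ : CNF ℕ}
    (hφ : φ ∈ (randomKCNF k n m).support) : φ.length = m ∨ φ = [] := by
  unfold randomKCNF at hφ
  split_ifs at hφ with h
  · haveI : Nonempty ↥(kClauses k n) := h.coe_sort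
    rw [PMF.support_map] at hφ
    obtain ⟨c, -, rfl⟩ := hφ
    exact Or.inl (List.length_ofFn)
  · rw [PMF.support_pure, Set.mem_singleton_iff] at hφ
    exact Or.inr hφ

/-- The CNF code is longer than twice the number of clauses: `|enc φ| = 2|φ| + 2 + …`. [folklore] -/
theorem two_mul_length_le_length_encode (φ : CNF ℕ) :
    2 * φ.length + 2 ≤ (encodingCNF.encode φ).length := by
  show 2 * φ.length + 2 ≤ (boolPair (unaryEncodeNat φ.length) _).length
  rw [length_boolPair, show (unaryEncodeNat φ.length).length = φ.length from unary_decode_encode_nat _]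
  omega

/-- Compactness of sampled formulas: if `n ≤ m` then every `φ` in the support of `F_k(n, m)` has
`numVars φ ≤ |enc φ|`. [folklore] -/
theorem numVars_le_length_encode_of_mem_support {k n m : ℕ} (hnm : n ≤ m) {φ : CNF ℕ}
    (hφ : φ ∈ (randomKCNF k n m).support) : φ.numVars ≤ (encodingCNF.encode φ).length := by
  rcases length_eq_or_nil_of_mem_support hφ with hlen | rfl
  · calc φ.numVars ≤ n := numVars_le_of_mem_support hφ
      _ ≤ m := hnm
      _ = φ.length := hlen.symm
      _ ≤ 2 * φ.length + 2 := by omega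
      _ ≤ _ := two_mul_length_le_length_encode φ
  · simp [CNF.numVars]

/-! ### The window is non-empty: `10 log k ≤ k` for `k ≥ 512` -/

/-- For `k ≥ 512`, `5 · 2^k · log k / k ≤ 2^k / 2`. [folklore] -/
theorem window_lower_le_half {k : ℕ} (hk : 512 ≤ k) :
    5 * 2 ^ k * Real.log k / k ≤ (2 : ℝ) ^ k / 2 := by
  have hk0 : (0 : ℝ) < k := by exact_mod_cast (show 0 < k by omega)
  have hk' : (512 : ℝ) ≤ k := by exact_mod_cast hk
  -- log k = log (k/40) + log 40 ≤ (k/40 - 1) + 39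
  have h40 : Real.log 40 ≤ 39 := by
    have := Real.log_le_sub_one_of_pos (show (0 : ℝ) < 40 by norm_num)
    linarith
  have hlogk : Real.log k ≤ k / 40 + 38 := by
    have h1 : Real.log ((k : ℝ) / 40) ≤ k / 40 - 1 := Real.log_le_sub_one_of_pos (by positivity)
    have h2 : Real.log ((k : ℝ) / 40) = Real.log k - Real.log 40 :=
      Real.log_div hk0.ne' (by norm_num)
    linarith
  have hpow : (0 : ℝ) < 2 ^ k := by positivity
  rw [div_le_iff₀ hk0]
  -- 5 * 2^k * log k ≤ 2^k / 2 * k  ⟸  10 log k ≤ k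
  have h10 : 10 * Real.log k ≤ k := by linarith
  nlinarith

/-! ### Mass bookkeeping under a `PMF` -/

/-- A `PMF` gives every set mass at most `1`. [folklore] -/
theorem toOuterMeasure_apply_le_one {α : Type} (p : PMF α) (s : Set α) :
    p.toOuterMeasure s ≤ 1 := by
  rw [PMF.toOuterMeasure_apply, ← p.tsum_coe]
  exact ENNReal.tsum_le_tsum fun x => Set.indicator_le_self s p x

/-- If `ε ≤ p(S)` and `p(T) < ε/2` (real masses) then `S \ T` meets the support of `p`. [folklore] -/
theorem exists_mem_support_diff {α : Type} (p : PMF α) (S T : Set α) {ε : ℝ} (hε : 0 < ε)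
    (hS : ε ≤ (p.toOuterMeasure S).toReal) (hT : (p.toOuterMeasure T).toReal < ε / 2) :
    ∃ x ∈ p.support, x ∈ S \ T := by
  have hfin : ∀ U : Set α, p.toOuterMeasure U ≠ ⊤ := fun U =>
    ((toOuterMeasure_apply_le_one p U).trans_lt ENNReal.one_lt_top).ne
  by_contra hcon
  have hdisj : Disjoint p.support (S \ T) :=
    Set.disjoint_left.2 fun x hx hx' => hcon ⟨x, hx, hx'⟩
  have h0 : p.toOuterMeasure (S \ T) = 0 := (PMF.toOuterMeasure_apply_eq_zero_iff p _).2 hdisj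
  have hsub : S ⊆ T ∪ (S \ T) := by
    intro x hx
    by_cases hxT : x ∈ T
    · exact Or.inl hxT
    · exact Or.inr ⟨hx, hxT⟩
  have hle : p.toOuterMeasure S ≤ p.toOuterMeasure T + p.toOuterMeasure (S \ T) :=
    (MeasureTheory.measure_mono hsub).trans (MeasureTheory.measure_union_le _ _)
  rw [h0, add_zero] at hle
  have : (p.toOuterMeasure S).toReal ≤ (p.toOuterMeasure T).toReal := ENNReal.toReal_mono (hfin T) hle
  linarith

end ForgingThesisSplit

/-! ### The assembly -/

open Literature.Computability.Complexity Filter ForgingThesisSplit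
  Summit.PneNP.PneNP.Theses.WitnessForging in
/-- **The deciding crux from its pieces**: `ShatteredForgingHard → WindowSatisfiable → ForgingThesis`
(`WindowSatisfiable` = item stmt-PneNP-17539: uniformly positive satisfiability of `F_k(n, ⌊αn⌋)` for
`k ≥ k₁`, `α ≤ 2^{k-1}`). Fix a PPT `A`;
at `k = max k₀ k₁ ⊔ 512` and `α = 2^k/2` (inside the window, `window_lower_le_half`) the mass of
`{Φ satisfiable ∧ A 1/4-forges μ_Φ}` under `F_k(n, ⌊αn⌋)` is eventually `< ε/2` while
`{Φ satisfiable}` keeps mass `≥ ε`; a formula of the support in the difference is satisfiable, compact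
(`numVars_le_length_encode_of_mem_support`, as `n ≤ ⌊αn⌋`) and not forged by `A`.
[cite: AchlioptasPeres2004, Thm 2] [folklore] -/
theorem forgingThesis_of_split (hH : ShatteredForgingHard) (hS : WindowSatisfiable) :
    ForgingThesis := by
  intro A hA
  obtain ⟨k₀, hk₀⟩ := hH
  obtain ⟨k₁, hk₁⟩ := hS
  set k : ℕ := max (max k₀ k₁) 512 with hk
  have hk0k : k ≥ k₀ := le_trans (le_max_left _ _) (le_max_left _ _)
  have hk1k : k ≥ k₁ := le_trans (le_max_right _ _) (le_max_left _ _)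
  have hk512 : 512 ≤ k := le_max_right _ _
  set α : ℝ := 2 ^ k / 2 with hα
  have hwin1 : 5 * 2 ^ k * Real.log k / k ≤ α := window_lower_le_half hk512
  have hwin2 : 2 * α ≤ 2 ^ k := by rw [hα]; linarith
  have hT := hk₀ k hk0k α hwin1 hwin2 A hA
  obtain ⟨ε, hε, hev⟩ := hk₁ k hk1k α hwin2
  have hevT := Filter.Tendsto.eventually_lt_const (half_pos hε) hT
  obtain ⟨n, hn1, hn2, hn3⟩ := (hevT.and (hev.and (eventually_ge_atTop 1))).exists
  have hα1 : (1 : ℝ) ≤ α := by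
    have h2k : (2 : ℝ) ≤ 2 ^ k :=
      calc (2 : ℝ) = 2 ^ 1 := by norm_num
        _ ≤ 2 ^ k := pow_le_pow_right₀ (by norm_num) (by omega)
    rw [hα]
    linarith
  have hnm : n ≤ ⌊α * n⌋₊ := by
    apply Nat.le_floor
    calc (n : ℝ) = 1 * n := by ring
      _ ≤ α * n := mul_le_mul_of_nonneg_right hα1 (Nat.cast_nonneg n)
  obtain ⟨φ, hφsupp, hφS, hφT⟩ := exists_mem_support_diff _ _ _ hε hn2 hn1
  have hsat : φ.Satisfiable := hφS
  refine ⟨φ, hsat, numVars_le_length_encode_of_mem_support hnm hφsupp, ?_⟩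
  by_contra hcon
  push Not at hcon
  exact hφT ⟨hsat, hcon⟩


/-- **Item `ForgingThesisOfPieces` (stmt-PneNP-17540) of route WitnessForging** — the glue
`ShatteredForgingHard → WindowSatisfiable → ForgingThesis` of the BC2 redirect of the deciding crux,
by `forgingThesis_of_split`. [folklore] -/
theorem forgingThesisOfPieces_proof :
    Summit.PneNP.PneNP.Theses.WitnessForging.ForgingThesisOfPieces :=
  fun hH hS => forgingThesis_of_split hH hS

end Summit.PneNP.PneNP.Theorems
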